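import Summits.QuantumFields.YangMills.Theorems.CurvatureBoostCovariance.Negative.Unbundled
import Summits.QuantumFields.YangMills.Theorems.NPointIsotropy.Negative.NPointRegularJunk
import Summits.QuantumFields.YangMills.Theorems.PencilRigidityNPointIsotropyMopupHelpers
import Summits.QuantumFields.YangMills.Theorems.PencilRigidityNPointIsotropyBandlimit
import Literature.MathematicalPhysics.QuantumFieldTheory.OSLorentzInvariance

/-!
# `MirrorModularBoosts.CurvatureBoostCovariance`, line `boosts-inherit-mirrors`: stub `stub_doubledToInvariant`

Stub `stub_doubledToInvariant` (Stub 6, "from doubled orbits to `⁰𝒮`") of the checked skeleton of line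
`boosts-inherit-mirrors`, crux `stmt-QuantumFields-9663`
(`Summit.QuantumFields.YangMills.Theses.MirrorModularBoosts.CurvatureBoostCovariance`), proved over the tree.

Statement. Let `S₁` be a one-species Schwinger family on `ℝ⁴` with the OS package (only E3 on `⁰𝒮` is used),
translation invariance on `⁰𝒮` and the Step-0 residual `NPointRegular S₁` (`𝔖_N|⁰𝒮 = ∫ W_N ·`). Fix a level `b`.
If for all compactly supported time-ordered `F` (degree `n ≤ b`), `G` (degree `m ≤ b`) and every witness `H` of
`ΘF* ⊗ G` the orbit `θ ↦ 𝔖_{n+m}(R_θ · H)` (`R_θ = planeRot 0 θ`) is constant, then `𝔖_N(R · F) = 𝔖_N(F)` for all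
`N ≤ 2b`, all determinant-one linear isometries `R` of `ℝ⁴` fixing `e₂, e₃` and all `F ∈ ⁰𝒮_N` — GIVEN, as the
explicit first hypothesis, the tensor-density statement of the neighbouring stub `stub_tensorDensity`
(du Bois-Reymond for appended tensors `Φ ⊗ Ψ` on product sets `U ×' V`).

Proof. `R = planeRot 0 φ` (`Mopup.exists_eq_planeRot`); split `N = n + m`, `n, m ≤ b`. With `W = W_{n+m}` and the
defect `D := W ∘ R - W`: `∫ D·K = 𝔖(R·K) - 𝔖(K)` for off-diagonal `K` (`Mopup.integral_mul_linActMulti`), and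
`D ∈ L¹_loc` off the coincidence locus (test against an off-diagonal bump). On the cut chamber `O₀ = C₋ ×' C₊`
(negative resp. positive strictly increasing times) a tensor `Φ ⊗ Ψ`, `Φ ∈ C_c^∞(C₋)`, `Ψ ∈ C_c^∞(C₊)`, is the
doubled test function `Θ(ΘΦ*)* ⊗ Ψ` with `ΘΦ*`, `Ψ` time-ordered, so its orbit is constant and `∫ D·(Φ ⊗ Ψ) = 0`;
the density hypothesis gives `∫ D·K = 0` on `C_c^∞(O₀)`. E3 and translations transport this to
`O_{π,a} = {x | x ∘ π - a ∈ O₀}` (the diagonal action commutes with permutations and intertwines translations), so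
`D = 0` a.e. on each `O_{π,a}` (`IsOpen.ae_eq_zero_of_integral_contDiff_smul_eq_zero`); the countably many
`O_{π, c e₀}`, `c ∈ ℚ`, cover the configurations with pairwise distinct times (sort the times, put a rational between
the `n`-th and the `(n+1)`-st), whose complement is a finite union of null hyperplanes (`Mopup.volume_setOf_coord_eq`).
Hence `D = 0` a.e. and `𝔖(R·F) = 𝔖(F)` on `⁰𝒮`. References: folklore (du Bois-Reymond; Osterwalder–Schrader,
Comm. Math. Phys. 31 (1973) §4.2 for the change of variables). Helpers in the sub-namespace `DoubledToInvariant`; no `def`.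
-/

noncomputable section

-- tree-known workaround (keep this line, it is in every landed Negative/*.lean file):
attribute [-instance] SimplexCategory.instFintypeToTypeOrderHomFinHAddNatLenOfNat

namespace Summit.QuantumFields.YangMills.Theorems.CurvatureBoostCovariance.BoostsInheritMirrors

open scoped BigOperators SchwartzMap
open MeasureTheory Filter Topology
open Literature.MathematicalPhysics.QuantumLattice Literature.MathematicalPhysics.AQFT
  Literature.MathematicalPhysics.QuantumFieldTheory
open Summit.QuantumFields.YangMills.Theorems.NPointIsotropy.Negative (E4 NPointRegular)
open Summit.QuantumFields.YangMills.Theorems.CurvatureBoostCovariance.Negative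
  (OSPackage Translations Hypercubic EightFrameRP PlanarCone PlanarInvariant Tie Gaps W1 isOffDiagonal_linActMulti)
open Summit.QuantumFields.YangMills.Theorems.NPointIsotropy.ComplexRotationBandlimit

namespace DoubledToInvariant

variable {N : ℕ}

/-! ## Generic helpers -/

/-- The OS adjoint is an involution. [folklore] -/
theorem osAdjoint_osAdjoint' (F : 𝓢((Fin N → E4), ℂ)) : osAdjoint (osAdjoint F) = F := by
  ext x; simp

/-- The support of `ΘΦ*` is the reflected, reversed support of `Φ`. [folklore] -/
theorem tsupport_osAdjoint_subset' (F : 𝓢((Fin N → E4), ℂ)) :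
    tsupport ((osAdjoint F : 𝓢((Fin N → E4), ℂ)) : (Fin N → E4) → ℂ) ⊆
      (fun x => fun i => timeReflection 4 (x (Fin.rev i))) ⁻¹' tsupport (F : (Fin N → E4) → ℂ) := by
  refine closure_minimal (fun x hx => ?_) ((isClosed_tsupport _).preimage
    (continuous_pi fun i => (timeReflection 4).continuous.comp (continuous_apply (Fin.rev i))))
  rw [Function.mem_support, osAdjoint_apply] at hx
  exact subset_closure (Function.mem_support.2 fun h0 => hx (by rw [h0, map_zero]))

/-- `ΘΦ*` has compact support if `Φ` has. [folklore] -/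
theorem hasCompactSupport_osAdjoint' {F : 𝓢((Fin N → E4), ℂ)} (hF : HasCompactSupport (F : (Fin N → E4) → ℂ)) :
    HasCompactSupport ((osAdjoint F : 𝓢((Fin N → E4), ℂ)) : (Fin N → E4) → ℂ) := by
  set τ : (Fin N → E4) → (Fin N → E4) := fun y i => timeReflection 4 (y (Fin.rev i)) with hτ
  have hτc : Continuous τ := continuous_pi fun i => (timeReflection 4).continuous.comp (continuous_apply _)
  have hττ : ∀ y, τ (τ y) = y := fun y => by funext i; simp [hτ, Fin.rev_rev, timeReflection_timeReflection]
  refine HasCompactSupport.intro (hF.isCompact.image hτc) fun y hy => ?_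
  rw [osAdjoint_apply]
  exact (congrArg _ (image_eq_zero_of_notMem_tsupport fun h => hy ⟨τ y, h, hττ y⟩)).trans (map_zero _)

/-- If `Φ` is supported in the negative ordered chamber then `ΘΦ*` is time-ordered. [folklore] -/
theorem isTimeOrdered_osAdjoint_of {Φ : 𝓢((Fin N → E4), ℂ)}
    (hΦ : tsupport (Φ : (Fin N → E4) → ℂ) ⊆ {x | (∀ i, x i 0 < 0) ∧ StrictMono fun i => x i 0}) :
    IsTimeOrdered (osAdjoint Φ) := by
  intro y hy
  obtain ⟨hneg, hmono⟩ := hΦ (tsupport_osAdjoint_subset' Φ hy)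
  refine ⟨fun i => ?_, fun i j hij => ?_⟩
  · have h := hneg (Fin.rev i)
    simp only [Fin.rev_rev, timeReflection_apply, if_true] at h; linarith
  · have h := hmono (Fin.rev_lt_rev.2 hij)
    simp only [Fin.rev_rev, timeReflection_apply, if_true] at h; linarith

/-- The coincidence locus is closed. [folklore] -/
theorem isClosed_coincidenceLocus' (N : ℕ) : IsClosed (coincidenceLocus N E4) := by
  have h : coincidenceLocus N E4 = ⋃ i : Fin N, ⋃ j : Fin N, ⋃ (_ : i ≠ j), {x | x i = x j} := by
    ext x; simp [coincidenceLocus]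
  rw [h]
  exact isClosed_iUnion_of_finite fun i => isClosed_iUnion_of_finite fun j =>
    isClosed_iUnion_of_finite fun _ => isClosed_eq (continuous_apply i) (continuous_apply j)

/-- `⁰𝒮` is stable under permutations of the arguments. [folklore] -/
theorem isOffDiagonal_permTest {F : 𝓢((Fin N → E4), ℂ)} (hF : IsOffDiagonal F) (σ : Equiv.Perm (Fin N)) :
    IsOffDiagonal (permTest σ F) := by
  intro x hx k
  set g : (Fin N → E4) ≃L[ℝ] (Fin N → E4) := (LinearEquiv.funCongrLeft ℝ E4 σ).toContinuousLinearEquiv with hg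
  have hg_apply : ∀ y, g y = y ∘ σ := fun y => rfl
  have hfun : ((permTest σ F : 𝓢((Fin N → E4), ℂ)) : (Fin N → E4) → ℂ) = (F : (Fin N → E4) → ℂ) ∘ g := by
    funext y; rw [Function.comp_apply, permTest_apply, hg_apply]
  have hgx : g x ∈ coincidenceLocus N E4 := by
    obtain ⟨i, j, hij, hxij⟩ := hx
    exact ⟨σ.symm i, σ.symm j, fun h => hij (σ.symm.injective h), by simp [hg_apply, hxij]⟩
  have key := (g : (Fin N → E4) →L[ℝ] (Fin N → E4)).iteratedFDeriv_comp_right (F.smooth k) x (i := k) le_rfl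
  simp only [ContinuousLinearEquiv.coe_coe] at key
  rw [hfun, key, hF _ hgx k]
  ext v; simp

/-- If `D·G` is integrable for every off-diagonal test function `G`, then `D` is locally integrable off the
coincidence locus (test against an off-diagonal bump `≡ 1` near each point). [folklore] -/
theorem locallyIntegrableOn_of_offDiagonal {D : (Fin N → E4) → ℂ}
    (h : ∀ G : 𝓢((Fin N → E4), ℂ), IsOffDiagonal G → Integrable (fun x => D x * G x)) :
    LocallyIntegrableOn D (coincidenceLocus N E4)ᶜ volume := by
  have hUo : IsOpen (coincidenceLocus N E4)ᶜ := (isClosed_coincidenceLocus' N).isOpen_compl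
  intro x hx
  obtain ⟨ε, hε, hball⟩ := Metric.isOpen_iff.1 hUo x hx
  let φ : ContDiffBump x := ⟨ε / 4, ε / 2, by positivity, by linarith⟩
  have hφs : HasCompactSupport fun y => ((φ y : ℝ) : ℂ) := φ.hasCompactSupport.comp_left Complex.ofReal_zero
  have hφd : ContDiff ℝ ((⊤ : ℕ∞) : WithTop ℕ∞) fun y => ((φ y : ℝ) : ℂ) :=
    Complex.ofRealCLM.contDiff.comp φ.contDiff
  set G : 𝓢((Fin N → E4), ℂ) := hφs.toSchwartzMap hφd with hGdef
  have hG_apply : ∀ y, G y = ((φ y : ℝ) : ℂ) := fun y => rfl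
  have hGsupp : tsupport (G : (Fin N → E4) → ℂ) ⊆ (coincidenceLocus N E4)ᶜ := by
    intro y hy
    have hy' : y ∈ tsupport (φ : (Fin N → E4) → ℝ) :=
      tsupport_comp_subset (g := fun r : ℝ => ((r : ℝ) : ℂ)) Complex.ofReal_zero _ hy
    rw [φ.tsupport_eq, show φ.rOut = ε / 2 from rfl] at hy'
    exact hball (Metric.closedBall_subset_ball (by linarith) hy')
  have hint : Integrable (fun y => D y * G y) := h G (IsOffDiagonal.of_tsupport_subset hGsupp)
  refine ⟨Metric.ball x (ε / 4), mem_nhdsWithin_of_mem_nhds (Metric.ball_mem_nhds x (by positivity)), ?_⟩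
  refine (hint.integrableOn (s := Metric.ball x (ε / 4))).congr_fun (fun y hy => ?_) measurableSet_ball
  have h1 : φ y = 1 := φ.one_of_mem_closedBall (Metric.ball_subset_closedBall hy)
  simp [hG_apply, h1]

/-- An ordered chamber `{x | (∀ i, p (xᵢ⁰)) ∧ x₁⁰ < ⋯ < x_N⁰}` (`p` an open condition) is open. [folklore] -/
theorem isOpen_chamber (N : ℕ) (p : ℝ → Prop) (hp : IsOpen {r | p r}) :
    IsOpen {x : Fin N → E4 | (∀ i, p (x i 0)) ∧ StrictMono fun i => x i 0} := by
  have h1 : IsOpen {x : Fin N → E4 | ∀ i, p (x i 0)} := by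
    rw [Set.setOf_forall]
    exact isOpen_iInter_of_finite fun i => hp.preimage (Mopup.continuous_coord i 0)
  have h2 : IsOpen {x : Fin N → E4 | StrictMono fun i => x i 0} := by
    have h : {x : Fin N → E4 | StrictMono fun i => x i 0} = ⋂ i, ⋂ j, {x | i < j → x i 0 < x j 0} := by
      ext x; simp [StrictMono]
    rw [h]
    refine isOpen_iInter_of_finite fun i => isOpen_iInter_of_finite fun j => ?_
    by_cases hij : i < j
    · simpa only [hij, true_implies] using isOpen_lt (Mopup.continuous_coord i 0) (Mopup.continuous_coord j 0)
    · simp [hij]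
  exact h1.inter h2

/-- A RATIONAL threshold between the first `n` and the last `m` values of a strictly increasing `(n+m)`-tuple of
reals. [folklore] -/
theorem exists_rat_sep {n m : ℕ} {s : Fin (n + m) → ℝ} (hs : StrictMono s) :
    ∃ c : ℚ, (∀ i : Fin n, s (Fin.castAdd m i) < c) ∧ ∀ j : Fin m, (c : ℝ) < s (Fin.natAdd n j) := by
  classical
  obtain ⟨r, hr₁, hr₂⟩ := Order.exists_between_finsets
    (Finset.univ.image fun i : Fin n => s (Fin.castAdd m i))
    (Finset.univ.image fun j : Fin m => s (Fin.natAdd n j)) (by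
      simp only [Finset.forall_mem_image, Finset.mem_univ, true_implies]
      intro i j
      exact hs (Fin.lt_def.2 (by simp only [Fin.val_castAdd, Fin.val_natAdd]; have := i.2; omega)))
  simp only [Finset.forall_mem_image] at hr₁ hr₂
  have hTo : IsOpen {c : ℝ | (∀ i : Fin n, s (Fin.castAdd m i) < c) ∧ ∀ j : Fin m, c < s (Fin.natAdd n j)} := by
    simp only [Set.setOf_and, Set.setOf_forall]
    exact (isOpen_iInter_of_finite fun i => isOpen_lt continuous_const continuous_id).inter
      (isOpen_iInter_of_finite fun j => isOpen_lt continuous_id continuous_const)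
  obtain ⟨q, hq⟩ := Rat.denseRange_cast.exists_mem_open hTo
    ⟨r, fun i => hr₁ (Finset.mem_univ i), fun j => hr₂ (Finset.mem_univ j)⟩
  exact ⟨q, hq.1, hq.2⟩

end DoubledToInvariant

open DoubledToInvariant in
/-- **Stub 6 of line `boosts-inherit-mirrors` (crux `MirrorModularBoosts.CurvatureBoostCovariance`,
stmt-QuantumFields-9663) — from doubled orbits to `⁰𝒮`.** Given the tensor-density statement (first hypothesis,
verbatim the neighbouring stub `stub_tensorDensity`): if every `𝔖_N|⁰𝒮` is integration against a function, `S₁` is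
E3-symmetric and translation invariant on `⁰𝒮`, and all doubled orbit functions `θ ↦ 𝔖_{n+m}(R_θ · H)`,
`H = ΘF* ⊗ G`, `deg F, deg G ≤ b` (compact supports, time-ordered) are constant, then `𝔖_N(R · F) = 𝔖_N(F)` for all
`N ≤ 2b`, all determinant-one isometries `R` fixing `e₂, e₃` and all `F ∈ ⁰𝒮_N`. See the module docstring for the
proof (defect function, cut chambers, E3/translation transport, countable rational cover, null hyperplanes).
[folklore] -/
theorem stub_doubledToInvariant :
    open Literature.MathematicalPhysics.QuantumLattice Literature.MathematicalPhysics.AQFT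
      Literature.MathematicalPhysics.QuantumFieldTheory
      Summit.QuantumFields.YangMills.Theorems.CurvatureBoostCovariance.Negative
      Summit.QuantumFields.YangMills.Theorems.NPointIsotropy.Negative in
    (∀ (n m : ℕ) (U : Set (Fin n → E4)) (V : Set (Fin m → E4)), IsOpen U → IsOpen V →
      ∀ D : (Fin (n + m) → E4) → ℂ,
        MeasureTheory.LocallyIntegrableOn D
          {x | (fun i => x (Fin.castAdd m i)) ∈ U ∧ (fun j => x (Fin.natAdd n j)) ∈ V} →
        (∀ (Φ : SchwartzMap (Fin n → E4) ℂ) (Ψ : SchwartzMap (Fin m → E4) ℂ),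
          HasCompactSupport (Φ : (Fin n → E4) → ℂ) → tsupport (Φ : (Fin n → E4) → ℂ) ⊆ U →
          HasCompactSupport (Ψ : (Fin m → E4) → ℂ) → tsupport (Ψ : (Fin m → E4) → ℂ) ⊆ V →
          ∀ H : SchwartzMap (Fin (n + m) → E4) ℂ, IsAppendTensorOf H Φ Ψ →
            ∫ x : Fin (n + m) → E4, D x * H x = 0) →
        ∀ K : SchwartzMap (Fin (n + m) → E4) ℂ, HasCompactSupport (K : (Fin (n + m) → E4) → ℂ) →
          tsupport (K : (Fin (n + m) → E4) → ℂ) ⊆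
            {x | (fun i => x (Fin.castAdd m i)) ∈ U ∧ (fun j => x (Fin.natAdd n j)) ∈ V} →
          ∫ x : Fin (n + m) → E4, D x * K x = 0) →
    ∀ (S₁ : SchwingerFamily E4), OSPackage S₁ → Translations S₁ → NPointRegular S₁ →
      ∀ b : ℕ,
        (∀ n m : ℕ, n ≤ b → m ≤ b →
          ∀ (F : SchwartzMap (Fin n → E4) ℂ) (G : SchwartzMap (Fin m → E4) ℂ),
            IsTimeOrdered F → IsTimeOrdered G →
            HasCompactSupport (F : (Fin n → E4) → ℂ) → HasCompactSupport (G : (Fin m → E4) → ℂ) →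
            ∀ H : SchwartzMap (Fin (n + m) → E4) ℂ, IsAppendTensorOf H (osAdjoint F) G →
              ∀ θ : ℝ, S₁ (n + m) (linActMulti (planeRot (0 : Fin 3) θ) H) = S₁ (n + m) H) →
        ∀ N : ℕ, N ≤ 2 * b → ∀ R : E4 ≃ₗᵢ[ℝ] E4,
          LinearMap.det (R.toLinearEquiv : E4 →ₗ[ℝ] E4) = 1 →
          R (EuclideanSpace.single 2 1) = EuclideanSpace.single 2 1 →
          R (EuclideanSpace.single 3 1) = EuclideanSpace.single 3 1 →
          ∀ F : SchwartzMap (Fin N → E4) ℂ, IsOffDiagonal F → S₁ N (linActMulti R F) = S₁ N F := by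
  intro hdens S₁ hOS htr hreg b hconst N hN R hdet h2 h3
  obtain ⟨φ, rfl⟩ := Mopup.exists_eq_planeRot R hdet h2 h3
  obtain ⟨n, m, hn, hm, rfl⟩ : ∃ n m : ℕ, n ≤ b ∧ m ≤ b ∧ N = n + m :=
    ⟨min N b, N - min N b, min_le_right N b, by omega, by omega⟩
  set L : E4 ≃ₗᵢ[ℝ] E4 := planeRot (d := 3) 0 φ with hL
  have hE3 : ∀ (π : Equiv.Perm (Fin (n + m))) (K : 𝓢((Fin (n + m) → E4), ℂ)), IsOffDiagonal K →
      S₁ (n + m) (permTest π K) = S₁ (n + m) K :=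
    fun π K hK => hOS.2.2.2.2.1 (n + m) (fun _ => ()) π K hK
  obtain ⟨W, hrep⟩ := hreg (n + m)
  /- (1) the defect `D = W ∘ ρ - W` integrates to `𝔖(L·K) - 𝔖(K)` against off-diagonal `K` -/
  set ρ : (Fin (n + m) → E4) → (Fin (n + m) → E4) := fun x k => L (x k) with hρ
  have hint : ∀ K : 𝓢((Fin (n + m) → E4), ℂ), IsOffDiagonal K →
      Integrable (fun x => W (ρ x) * K x) ∧ S₁ (n + m) (linActMulti L K) = ∫ x, W (ρ x) * K x := by
    intro K hK
    obtain ⟨h1, h2⟩ := hrep _ (isOffDiagonal_linActMulti hK L)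
    have hcomp : (fun x => W (ρ x) * K x) = (fun y => W y * linActMulti L K y) ∘ ρ := by
      funext x; simp [hρ, linActMulti_apply]
    exact ⟨hcomp ▸ (Mopup.measurePreserving_diag L).integrable_comp_of_integrable h1,
      h2.trans (Mopup.integral_mul_linActMulti L W K).symm⟩
  set D : (Fin (n + m) → E4) → ℂ := fun x => W (ρ x) - W x with hD
  have hDint : ∀ K : 𝓢((Fin (n + m) → E4), ℂ), IsOffDiagonal K →
      Integrable (fun x => D x * K x) ∧ ∫ x, D x * K x = S₁ (n + m) (linActMulti L K) - S₁ (n + m) K := by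
    intro K hK
    obtain ⟨⟨hA1, hA2⟩, hB1, hB2⟩ := And.intro (hint K hK) (hrep K hK)
    have hfun : (fun x => D x * K x) = fun x => W (ρ x) * K x - W x * K x := by funext x; simp only [hD]; ring
    rw [hfun]
    exact ⟨hA1.sub hB1, by rw [integral_sub hA1 hB1, hA2, hB2]⟩
  have hloc : LocallyIntegrableOn D (coincidenceLocus (n + m) E4)ᶜ volume :=
    locallyIntegrableOn_of_offDiagonal fun G hG => (hDint G hG).1
  /- (2) the cut chamber `O₀ = C₋ ×' C₊`, the distinct-times set `Ωt`, the open sets `O_{π,a}` -/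
  set O₀ : Set (Fin (n + m) → E4) := {x | (fun i => x (Fin.castAdd m i)) ∈
      {x : Fin n → E4 | (∀ i, x i 0 < 0) ∧ StrictMono fun i => x i 0} ∧ (fun j => x (Fin.natAdd n j)) ∈
      {y : Fin m → E4 | (∀ j, 0 < y j 0) ∧ StrictMono fun j => y j 0}} with hO₀
  have hmemO : ∀ z : Fin (n + m) → E4, z ∈ O₀ ↔
      ((∀ i, z (Fin.castAdd m i) 0 < 0) ∧ StrictMono fun i => z (Fin.castAdd m i) 0) ∧
        (∀ j, 0 < z (Fin.natAdd n j) 0) ∧ StrictMono fun j => z (Fin.natAdd n j) 0 := fun z => Iff.rfl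
  have hUo : IsOpen {x : Fin n → E4 | (∀ i, x i 0 < 0) ∧ StrictMono fun i => x i 0} :=
    isOpen_chamber n (· < 0) (isOpen_gt' 0)
  have hVo : IsOpen {y : Fin m → E4 | (∀ j, 0 < y j 0) ∧ StrictMono fun j => y j 0} :=
    isOpen_chamber m (0 < ·) (isOpen_lt' 0)
  have hcast : Continuous fun (x : Fin (n + m) → E4) (i : Fin n) => x (Fin.castAdd m i) :=
    continuous_pi fun i => continuous_apply _
  have hnat : Continuous fun (x : Fin (n + m) → E4) (j : Fin m) => x (Fin.natAdd n j) :=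
    continuous_pi fun j => continuous_apply _
  have hO₀o : IsOpen O₀ := (hUo.preimage hcast).inter (hVo.preimage hnat)
  set Ωt : Set (Fin (n + m) → E4) := {x | ∀ k l, k ≠ l → x k 0 ≠ x l 0} with hΩt
  have hmemΩt : ∀ z : Fin (n + m) → E4, z ∈ Ωt ↔ ∀ k l, k ≠ l → z k 0 ≠ z l 0 := fun z => Iff.rfl
  have hΩtc : Ωt ⊆ (coincidenceLocus (n + m) E4)ᶜ := fun z hz ⟨k, l, hkl, h⟩ => (hmemΩt z).1 hz k l hkl (by rw [h])
  have hO₀t : O₀ ⊆ Ωt := fun z hz k l hkl h => by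
    obtain ⟨⟨hneg, hmn⟩, hpos, hmp⟩ := (hmemO z).1 hz
    have hinj : Function.Injective fun k => z k 0 := by
      rw [← Fin.append_castAdd_natAdd (f := fun k => z k 0), Fin.append_injective_iff]
      exact ⟨hmn.injective, hmp.injective, fun i j hij => by linarith [hneg i, hpos j, hij.le, hij.ge]⟩
    exact hkl (hinj h)
  have hO₀c : O₀ ⊆ (coincidenceLocus (n + m) E4)ᶜ := hO₀t.trans hΩtc
  have hcontA : ∀ (π : Equiv.Perm (Fin (n + m))) (a : E4),
      Continuous fun (x : Fin (n + m) → E4) (k : Fin (n + m)) => x (π k) - a :=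
    fun π a => continuous_pi fun k => (continuous_apply _).sub continuous_const
  have hOc : ∀ (π : Equiv.Perm (Fin (n + m))) (a : E4),
      {x : Fin (n + m) → E4 | (fun k => x (π k) - a) ∈ O₀} ⊆ (coincidenceLocus (n + m) E4)ᶜ := by
    rintro π a x hx ⟨i, j, hij, hxij⟩
    have hz := (hmemΩt _).1 (hO₀t (show (fun k => x (π k) - a) ∈ O₀ from hx))
    exact hz (π.symm i) (π.symm j) (fun h => hij (π.symm.injective h)) (by simp [hxij])
  /- (3) the density hypothesis on `O₀`: `∫ D·K = 0` for `K ∈ C_c^∞(O₀)` -/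
  have hO0 : ∀ K : 𝓢((Fin (n + m) → E4), ℂ), HasCompactSupport (K : (Fin (n + m) → E4) → ℂ) →
      tsupport (K : (Fin (n + m) → E4) → ℂ) ⊆ O₀ → ∫ x, D x * K x = 0 := by
    refine hdens n m _ _ hUo hVo D (hloc.mono_set hO₀c) ?_
    intro Φ Ψ hΦc hΦs hΨc hΨs H hH
    have hH' : IsAppendTensorOf H (osAdjoint (osAdjoint Φ)) Ψ := by rw [osAdjoint_osAdjoint']; exact hH
    have hinv := hconst n m hn hm (osAdjoint Φ) Ψ (isTimeOrdered_osAdjoint_of hΦs) hΨs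
      (hasCompactSupport_osAdjoint' hΦc) hΨc H hH' φ
    have hP : IsClosed {x : Fin (n + m) → E4 | (fun i => x (Fin.castAdd m i)) ∈ tsupport (Φ : _ → ℂ) ∧
        (fun j => x (Fin.natAdd n j)) ∈ tsupport (Ψ : _ → ℂ)} :=
      ((isClosed_tsupport _).preimage hcast).inter ((isClosed_tsupport _).preimage hnat)
    have hHsupp : tsupport (H : _ → ℂ) ⊆ O₀ := by
      refine (closure_minimal (fun x hx => ?_) hP).trans fun x hx => ⟨hΦs hx.1, hΨs hx.2⟩
      rw [Function.mem_support, hH x] at hx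
      exact ⟨subset_closure (Function.mem_support.2 (left_ne_zero_of_mul hx)),
        subset_closure (Function.mem_support.2 (right_ne_zero_of_mul hx))⟩
    have hHoff : IsOffDiagonal H := IsOffDiagonal.of_tsupport_subset (hHsupp.trans hO₀c)
    rw [(hDint H hHoff).2, hinv, sub_self]
  /- (4) transport by E3 and translations: `∫ D·K = 0` for `K ∈ C_c^∞(O_{π,a})` -/
  have hkill : ∀ (π : Equiv.Perm (Fin (n + m))) (a : E4) (K : 𝓢((Fin (n + m) → E4), ℂ)),
      HasCompactSupport (K : (Fin (n + m) → E4) → ℂ) →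
      tsupport (K : (Fin (n + m) → E4) → ℂ) ⊆ {x | (fun k => x (π k) - a) ∈ O₀} → ∫ x, D x * K x = 0 := by
    intro π a K hKc hKs
    have hcontB : Continuous fun (y : Fin (n + m) → E4) (j : Fin (n + m)) => y (π.symm j) + a :=
      continuous_pi fun j => (continuous_apply _).add continuous_const
    have hAB : ∀ y : Fin (n + m) → E4, (fun k => y (π.symm (π k)) + a - a) = y := fun y => by funext k; simp
    have hKoff : IsOffDiagonal K := IsOffDiagonal.of_tsupport_subset (hKs.trans (hOc π a))
    -- the pulled-back test function `K₀ ∈ C_c^∞(O₀)`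
    set K₀ : 𝓢((Fin (n + m) → E4), ℂ) := translateMulti (-a) (permTest π.symm K) with hK₀
    have hK₀_apply : ∀ y, K₀ y = K (fun j => y (π.symm j) + a) := fun y => by
      simp only [hK₀, translateMulti_apply, permTest_apply, Function.comp_def, sub_neg_eq_add]
    have hK₀s' : tsupport (K₀ : _ → ℂ) ⊆ (fun y j => y (π.symm j) + a) ⁻¹' tsupport (K : _ → ℂ) := by
      refine closure_minimal (fun y hy => ?_) ((isClosed_tsupport _).preimage hcontB)
      rw [Function.mem_support, hK₀_apply] at hy
      exact subset_closure (Function.mem_support.2 hy)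
    have hK₀s : tsupport (K₀ : _ → ℂ) ⊆ O₀ := fun y hy => by simpa using hKs (hK₀s' hy)
    have hK₀c : HasCompactSupport (K₀ : _ → ℂ) := by
      refine HasCompactSupport.intro (hKc.isCompact.image (hcontA π a)) fun y hy => ?_
      rw [hK₀_apply]
      exact image_eq_zero_of_notMem_tsupport fun h => hy ⟨_, h, hAB y⟩
    have hK₀off : IsOffDiagonal K₀ := IsOffDiagonal.of_tsupport_subset (hK₀s.trans hO₀c)
    have h0 := hO0 K₀ hK₀c hK₀s
    rw [(hDint K₀ hK₀off).2, sub_eq_zero] at h0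
    -- `𝔖(K₀) = 𝔖(K)` and `𝔖(L·K₀) = 𝔖(L·K)` by E3 and translation invariance
    have e1 : S₁ (n + m) K₀ = S₁ (n + m) K := by
      rw [hK₀, htr _ _ _ (isOffDiagonal_permTest hKoff _), hE3 _ _ hKoff]
    have hcomm : linActMulti L K₀ = translateMulti (-L a) (permTest π.symm (linActMulti L K)) := by
      ext y
      simp only [linActMulti_apply, hK₀_apply, translateMulti_apply, permTest_apply, Function.comp_def,
        sub_neg_eq_add, map_add, LinearIsometryEquiv.symm_apply_apply]
    have e2 : S₁ (n + m) (linActMulti L K₀) = S₁ (n + m) (linActMulti L K) := by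
      rw [hcomm, htr _ _ _ (isOffDiagonal_permTest (isOffDiagonal_linActMulti hKoff L) _),
        hE3 _ _ (isOffDiagonal_linActMulti hKoff L)]
    rw [(hDint K hKoff).2, ← e2, h0, e1, sub_self]
  /- (5) `D = 0` a.e. on each `O_{π,a}` (du Bois-Reymond) -/
  have hae : ∀ (π : Equiv.Perm (Fin (n + m))) (a : E4),
      ∀ᵐ x ∂(volume : Measure (Fin (n + m) → E4)), x ∈ {x | (fun k => x (π k) - a) ∈ O₀} → D x = 0 := by
    intro π a
    refine ((hO₀o.preimage (hcontA π a)).ae_eq_zero_of_integral_contDiff_smul_eq_zero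
      (hloc.mono_set (hOc π a)) fun g hg hgs hgU => ?_)
    have hcs : HasCompactSupport fun y => ((g y : ℝ) : ℂ) := hgs.comp_left Complex.ofReal_zero
    set G : 𝓢((Fin (n + m) → E4), ℂ) := hcs.toSchwartzMap (Complex.ofRealCLM.contDiff.comp hg) with hGdef
    have hG_apply : ∀ y, G y = ((g y : ℝ) : ℂ) := fun y => rfl
    have hGsupp : tsupport (G : (Fin (n + m) → E4) → ℂ) ⊆ {x | (fun k => x (π k) - a) ∈ O₀} := by
      intro y hy
      have hy2 : y ∈ tsupport ((fun r : ℝ => ((r : ℝ) : ℂ)) ∘ g) := hy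
      exact hgU (tsupport_comp_subset (g := fun r : ℝ => ((r : ℝ) : ℂ)) Complex.ofReal_zero _ hy2)
    have heq : (fun y : Fin (n + m) → E4 => g y • D y) = fun y => D y * G y := by
      funext y; rw [hG_apply, Complex.real_smul, mul_comm]
    exact heq ▸ hkill π a G hcs hGsupp
  /- (6) the rational cover of the distinct-times set and its null complement -/
  have hcover : ∀ x ∈ Ωt, ∃ (π : Equiv.Perm (Fin (n + m))) (c : ℚ),
      (fun k => x (π k) - EuclideanSpace.single 0 (c : ℝ)) ∈ O₀ := by
    intro x hx
    have hinj : Function.Injective fun k => x k 0 := fun k l h => by_contra fun hkl => (hmemΩt x).1 hx k l hkl h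
    obtain ⟨π, hsm⟩ : ∃ π : Equiv.Perm (Fin (n + m)), StrictMono fun k => x (π k) 0 :=
      ⟨Tuple.sort fun k => x k 0,
        (Tuple.monotone_sort _).strictMono_of_injective (hinj.comp (Equiv.injective _))⟩
    obtain ⟨c, hc₁, hc₂⟩ := exists_rat_sep hsm
    refine ⟨π, c, (hmemO _).2 ⟨⟨fun i => ?_, fun i j hij => ?_⟩, fun j => ?_, fun i j hij => ?_⟩⟩
    · simpa using hc₁ i
    · simpa using hsm (Fin.strictMono_castAdd m hij)
    · simpa using hc₂ j
    · simpa using hsm (Fin.strictMono_natAdd n hij)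
  have hnull : volume Ωtᶜ = 0 := by
    have hsub : Ωtᶜ ⊆ ⋃ k : Fin (n + m), ⋃ l : Fin (n + m), ⋃ (_ : k ≠ l),
        {x : Fin (n + m) → E4 | x k 0 = x l 0} := by
      intro x hx
      simp only [Set.mem_compl_iff, hmemΩt, not_forall, not_not, exists_prop] at hx
      obtain ⟨k, l, hkl, h⟩ := hx
      exact Set.mem_iUnion.2 ⟨k, Set.mem_iUnion.2 ⟨l, Set.mem_iUnion.2 ⟨hkl, h⟩⟩⟩
    exact measure_mono_null hsub (measure_iUnion_null fun k => measure_iUnion_null fun l =>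
      measure_iUnion_null fun hkl => Mopup.volume_setOf_coord_eq k l hkl 0)
  /- (7) `D = 0` a.e., and the conclusion -/
  have hD0 : ∀ᵐ x ∂(volume : Measure (Fin (n + m) → E4)), D x = 0 := by
    have h1 : ∀ᵐ x ∂(volume : Measure (Fin (n + m) → E4)), ∀ (π : Equiv.Perm (Fin (n + m))) (c : ℚ),
        x ∈ {x | (fun k => x (π k) - EuclideanSpace.single 0 (c : ℝ)) ∈ O₀} → D x = 0 :=
      ae_all_iff.2 fun π => ae_all_iff.2 fun c => hae π _
    have h2 : ∀ᵐ x ∂(volume : Measure (Fin (n + m) → E4)), x ∈ Ωt := mem_ae_iff.2 hnull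
    filter_upwards [h1, h2] with x h1x h2x using (hcover x h2x).elim fun π hπ => hπ.elim (h1x π)
  intro F hF
  obtain ⟨-, hDF⟩ := hDint F hF
  have hae' : (fun x => D x * F x) =ᵐ[volume] fun _ => (0 : ℂ) := by
    filter_upwards [hD0] with x hx; simp [hx]
  rw [integral_congr_ae hae', integral_zero] at hDF
  exact sub_eq_zero.1 hDF.symm

end Summit.QuantumFields.YangMills.Theorems.CurvatureBoostCovariance.BoostsInheritMirrors

end
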